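import Mathlib.Analysis.SpecialFunctions.Trigonometric.Bounds
import Literature.Barriers.CriticalPhenomena.RigorousRGSmallParameterHHWWindow
import HarnessLib

/-!
# The last step of Hara–Hattori–Watanabe's Theorem 1.1 on the finite trigonometric product:
# closed forms of `μ_{2,N}`, `μ_{4,N}` and a quantitative `ĥ_N(ξ) ≈ e^{-μ_{2,N}ξ²}` (Hadamard-free PROOF)

Companion of `RigorousRGSmallParameterHHWReduction.lean` (the named halves `_thm21`, `_thm22` of
`HaraHattoriWatanabe2001_thm11` and the top layer under Newman's representation `_eqA1`),
`RigorousRGSmallParameterHHWGibbs.lean` (`ĥ_N` as a finite trigonometric product,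
`charFun_traj_eq_trigProd`) and `RigorousRGSmallParameterHHWWindow.lean`. The tree meanwhile
PROVES `_eqA1` by Hadamard's factorisation (`RigorousRGSmallParameterHHWNewman.lean`,
`HaraHattoriWatanabe2001_eqA1_holds`) and assembles
`HaraHattoriWatanabe2001_thm11_of_thm21_of_thm22` (`RigorousRGSmallParameterNarrowReduction.lean`);
this file is an ELEMENTARY treatment of the same last step (p. 6 of the paper) — Hadamard-free as
a PROOF (the import closure still contains `…HHWNewman` through `…HHWWindow`, so the trust base
is unchanged) — which in addition yields the truncated correlations of the trajectory in closed
form and a quantitative error bound the tree does not have: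

* `moments_eq_of_charFun_expansion` — `m₂, m₄` from a fourth-order expansion of `ĥ` at `0`
  (uniqueness of Taylor expansions, Mathlib's `taylor_isLittleO_univ` for `charFun`).
* Fourth-order expansions at `0`: `cos_isLittleO`, `sin_sq_isLittleO`, `log_cos_isLittleO`
  (`log cos y = -y²/2 - y⁴/12 + o(y⁴)`), `log_one_sub_mul_sin_sq_isLittleO`
  (`log(1 - q sin²y) = -qy² - (q²/2 - q/3)y⁴ + o(y⁴)`), and for the product
  `F(t) = cos(ωt)^a ∏_q (1 - q sin²(ωt))` (`trigProd`): `logTrigProd_isLittleO`,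
  `trigProd_isLittleO` (`F = 1 - At² + (A²/2 - C)t⁴ + o(t⁴)`, `A = ω²(a/2 + Σq)`,
  `C = ω⁴(a/12 + Σ(q²/2 - q/3))`).
* `traj_trigProd_data` — for `s > 0`: `ĥ_N = F` with `q = 1/sin²(θ/2) ≥ 1` over the paired
  Lee–Yang angles, `a + 2|Q| = 2^N`, and the CLOSED FORMS `μ_{2,N} = ω²(a/2 + Σq)`,
  `μ_{4,N} = ω⁴(a/12 + Σ(q²/2 - q/3))`, `ω = s(√c/2)^N` (the Newman coordinates of §2.2 made
  finite; in particular `ω⁴ ≤ 12 μ_{4,N}`, `ω⁴Σq² ≤ 6 μ_{4,N}`).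
* `abs_neg_log_trigProd_sub_le` — the quantitative mechanism of p. 6:
  `|-log F(t) - (a/2 + Σq)(ωt)²| ≤ (a/2 + (5/12)Σq + 2Σq²)(ωt)⁴` under `|ωt| ≤ ½`, `q(ωt)² ≤ ½`.
* `eventually_charFun_traj_log_bound` — **quantitative form of the last step**: if `μ_{4,N} → 0`
  then eventually `ĥ_N(ξ) = F_N > 0` (real) with `|-log F_N - μ_{2,N}ξ²| ≤ 21 μ_{4,N}ξ⁴` (from
  `ω⁴ ≤ 12μ₄`, `ω⁴Σq² ≤ 6μ₄`); the limit `ĥ_N(ξ) → e^{-ξ²}` itself is the tree's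
  `tendsto_charFun_traj` (`…HHWReduction`, unconditional via `HaraHattoriWatanabe2001_eqA1_holds`).

## References

* T. Hara, T. Hattori, H. Watanabe, Comm. Math. Phys. 220 (2001) 13–40, §2.1–§2.3 (p. 6,
  "Proof of Theorem 1.1 for `d = 4` assuming Theorem 2.1 and Theorem 2.2").
* C. M. Newman, Comm. Math. Phys. 41 (1975) 1–9, Theorem 3 (signs of the cumulants).
-/

noncomputable section

namespace Literature.Barriers.CriticalPhenomena

open _root_.MeasureTheory _root_.ProbabilityTheory _root_.Filter _root_.Set _root_.Asymptotics
open Literature.Probability.LatticeModels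
open _root_.Complex (I)
open scoped _root_.Topology _root_.ENNReal _root_.NNReal BigOperators

namespace HierarchicalRG

/-! ### Moments from a fourth-order expansion of the characteristic function -/

/-- **Second and fourth moments from an expansion of `ĥ`**: if `ĥ(t) = F(t)` (real) with
`F(t) = 1 - At² + Bt⁴ + o(t⁴)` at `0` and `h` has a fourth moment, then `m₂ = 2A`, `m₄ = 24B`
(uniqueness of the Taylor expansion of `ĥ` at `0`). [folklore] -/
theorem moments_eq_of_charFun_expansion {ν : Measure ℝ} [IsProbabilityMeasure ν] (h4 : MemLp id 4 ν)
    {F : ℝ → ℝ} {A B : ℝ} (hchar : ∀ t : ℝ, charFun ν t = (F t : ℂ))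
    (hF : (fun t : ℝ => F t - (1 - A * t ^ 2 + B * t ^ 4)) =o[𝓝 0] fun t : ℝ => t ^ 4) :
    (∫ x, x ^ 2 ∂ν) = 2 * A ∧ (∫ x, x ^ 4 ∂ν) = 24 * B := by
  have hT : (fun t : ℝ => charFun ν t - taylorWithinEval (charFun ν) 4 univ 0 t) =o[𝓝 0]
      fun t : ℝ => t ^ 4 := by
    have := taylor_isLittleO_univ (x₀ := 0) (n := 4) (contDiff_charFun h4)
    simpa using this
  have hPr : (fun t : ℝ => charFun ν t - ((1 - A * t ^ 2 + B * t ^ 4 : ℝ) : ℂ)) =o[𝓝 0]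
      fun t : ℝ => t ^ 4 := by
    have h2 := Complex.isLittleO_ofReal_left.2 hF
    refine h2.congr' ?_ EventuallyEq.rfl
    exact Eventually.of_forall fun t => by beta_reduce; rw [hchar t]; push_cast; ring
  have hD := hPr.sub hT
  have hform : (fun t : ℝ => (charFun ν t - ((1 - A * t ^ 2 + B * t ^ 4 : ℝ) : ℂ)) -
      (charFun ν t - taylorWithinEval (charFun ν) 4 univ 0 t)) =
      fun t : ℝ => ((∫ x, x ^ 0 ∂ν : ℝ) - 1 : ℂ) + ((∫ x, x ^ 1 ∂ν : ℝ) * I : ℂ) * t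
        + (-(∫ x, x ^ 2 ∂ν : ℝ) / 2 + A : ℂ) * t ^ 2
        + (-(∫ x, x ^ 3 ∂ν : ℝ) * I / 6 : ℂ) * t ^ 3
        + ((∫ x, x ^ 4 ∂ν : ℝ) / 24 - B : ℂ) * t ^ 4 := by
    funext t
    rw [taylorWithinEval_charFun_zero h4 t]
    simp only [Finset.sum_range_succ, Finset.sum_range_zero, Nat.factorial, zero_add]
    push_cast
    have hI3 : I ^ 3 = -I := by rw [pow_succ, Complex.I_sq]; ring
    have hI4 : I ^ 4 = 1 := by rw [show (4 : ℕ) = 2 + 2 from rfl, pow_add, Complex.I_sq]; ring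
    simp only [mul_pow, Complex.I_sq, hI3, hI4]
    ring
  rw [hform] at hD
  obtain ⟨-, -, h2, -, h4'⟩ := coeff_eq_zero_of_isLittleO hD
  have h2r : (-(∫ x, x ^ 2 ∂ν) / 2 + A : ℝ) = 0 := by exact_mod_cast h2
  have h4r : ((∫ x, x ^ 4 ∂ν) / 24 - B : ℝ) = 0 := by exact_mod_cast h4'
  constructor
  · linarith
  · linarith

/-! ### Fourth-order expansions at `0` of `cos`, `sin²` and their logarithms -/

/-- `cos y = 1 - y²/2 + y⁴/24 + o(y⁴)`. [folklore] -/
theorem cos_isLittleO :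
    (fun y : ℝ => Real.cos y - (1 - y ^ 2 / 2 + y ^ 4 / 24)) =o[𝓝 0] fun y : ℝ => y ^ 4 := by
  have h := taylor_isLittleO_univ (x₀ := 0) (n := 4) (Real.contDiff_cos (n := 4))
  have d0 : iteratedDeriv 0 Real.cos 0 = 1 := by simp
  have d1 : iteratedDeriv 1 Real.cos 0 = 0 := by simp
  have d2 : iteratedDeriv 2 Real.cos 0 = -1 := by simp
  have d3 : iteratedDeriv 3 Real.cos 0 = 0 := by simp
  have d4 : iteratedDeriv 4 Real.cos 0 = 1 := by simp
  have ht : ∀ y : ℝ, taylorWithinEval Real.cos 4 univ 0 y = 1 - y ^ 2 / 2 + y ^ 4 / 24 := by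
    intro y
    rw [taylor_within_apply]
    simp only [Finset.sum_range_succ, Finset.sum_range_zero, zero_add, sub_zero,
      iteratedDerivWithin_univ, d0, d1, d2, d3, d4]
    norm_num [Nat.factorial]
    ring
  simp only [ht, sub_zero] at h
  exact h

/-- `sin² y = y² - y⁴/3 + o(y⁴)` (from `sin² y = (1 - cos 2y)/2`). [folklore] -/
theorem sin_sq_isLittleO :
    (fun y : ℝ => Real.sin y ^ 2 - (y ^ 2 - y ^ 4 / 3)) =o[𝓝 0] fun y : ℝ => y ^ 4 := by
  have h2 : Tendsto (fun y : ℝ => 2 * y) (𝓝 0) (𝓝 0) := by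
    have := (tendsto_id (x := 𝓝 (0 : ℝ))).const_mul 2
    simpa using this
  have h := (cos_isLittleO.comp_tendsto h2).const_mul_left (-1 / 2)
  have h' : (fun y : ℝ => (2 * y) ^ 4) =O[𝓝 0] fun y : ℝ => y ^ 4 :=
    (isBigO_const_mul_self (16 : ℝ) (fun y : ℝ => y ^ 4) (𝓝 0)).congr_left fun y => by ring
  refine (h.trans_isBigO h').congr' (Eventually.of_forall fun y => ?_) EventuallyEq.rfl
  simp only [Function.comp_apply, Real.sin_sq_eq_half_sub]
  ring

/-- `log(1 - v) + v + v²/2 = O(v³)` along any function `v → 0` with `v ≥ 0`. [folklore] -/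
theorem log_one_sub_isBigO {v : ℝ → ℝ} (hv0 : ∀ᶠ y in 𝓝 (0 : ℝ), 0 ≤ v y)
    (hv : Tendsto v (𝓝 0) (𝓝 0)) :
    (fun y => Real.log (1 - v y) + v y + v y ^ 2 / 2) =O[𝓝 0] fun y => v y ^ 3 := by
  refine IsBigO.of_bound 2 ?_
  filter_upwards [hv0, hv.eventually_le_const (show (0 : ℝ) < 1 / 2 by norm_num)] with y h0 h1
  rw [Real.norm_eq_abs, Real.norm_eq_abs, abs_of_nonneg (pow_nonneg h0 3)]
  exact abs_log_one_sub_add_add_le h0 h1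

/-- `log cos y + y²/2 + y⁴/12 = o(y⁴)`. [folklore] -/
theorem log_cos_isLittleO :
    (fun y : ℝ => Real.log (Real.cos y) + y ^ 2 / 2 + y ^ 4 / 12) =o[𝓝 0] fun y : ℝ => y ^ 4 := by
  set v : ℝ → ℝ := fun y => 1 - Real.cos y with hv
  have hv0 : ∀ᶠ y in 𝓝 (0 : ℝ), 0 ≤ v y := Eventually.of_forall fun y => by
    simp only [hv]; linarith [Real.cos_le_one y]
  have hvt : Tendsto v (𝓝 0) (𝓝 0) := by
    have : Tendsto v (𝓝 0) (𝓝 (1 - Real.cos 0)) := (continuous_const.sub Real.continuous_cos).tendsto 0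
    simpa using this
  -- `v - (y²/2 - y⁴/24) = o(y⁴)` and `v - y²/2 = O(y⁴)`, `v + y²/2 = O(y²)`
  have h1 : (fun y => v y - (y ^ 2 / 2 - y ^ 4 / 24)) =o[𝓝 0] fun y : ℝ => y ^ 4 := by
    refine (cos_isLittleO.const_mul_left (-1)).congr' (Eventually.of_forall fun y => ?_)
      EventuallyEq.rfl
    simp only [hv]; ring
  have h42 : (fun y : ℝ => y ^ 4) =O[𝓝 0] fun y : ℝ => y ^ 2 :=
    (isLittleO_pow_pow (by norm_num : 2 < 4)).isBigO
  have hA : (fun y => v y - y ^ 2 / 2) =O[𝓝 0] fun y : ℝ => y ^ 4 := by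
    have := h1.isBigO.sub (isBigO_const_mul_self ((1:ℝ) / 24) (fun y : ℝ => y ^ 4) (𝓝 0))
    refine this.congr' (Eventually.of_forall fun y => ?_) EventuallyEq.rfl
    ring
  have hB : (fun y => v y + y ^ 2 / 2) =O[𝓝 0] fun y : ℝ => y ^ 2 := by
    have := (hA.trans h42).add (isBigO_const_mul_self (1 : ℝ) (fun y : ℝ => y ^ 2) (𝓝 0))
    refine this.congr' (Eventually.of_forall fun y => ?_) EventuallyEq.rfl
    ring
  have hvO : v =O[𝓝 0] fun y : ℝ => y ^ 2 := by
    have := (hA.trans h42).add (isBigO_const_mul_self (1 / 2 : ℝ) (fun y : ℝ => y ^ 2) (𝓝 0))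
    refine this.congr' (Eventually.of_forall fun y => ?_) EventuallyEq.rfl
    ring
  have hsq : (fun y => (v y ^ 2 - y ^ 4 / 4) / 2) =O[𝓝 0] fun y : ℝ => y ^ 6 := by
    have := (hA.mul hB).const_mul_left (1 / 2)
    refine this.congr' (Eventually.of_forall fun y => ?_) (Eventually.of_forall fun y => ?_)
    · ring
    · ring
  have hlog : (fun y => Real.log (1 - v y) + v y + v y ^ 2 / 2) =O[𝓝 0] fun y : ℝ => y ^ 6 := by
    refine (log_one_sub_isBigO hv0 hvt).trans ?_
    have := hvO.pow 3
    exact this.congr_right fun y => by ring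
  have h64 : (fun y : ℝ => y ^ 6) =o[𝓝 0] fun y : ℝ => y ^ 4 := isLittleO_pow_pow (by norm_num)
  have := ((hlog.trans_isLittleO h64).sub h1).sub (hsq.trans_isLittleO h64)
  refine this.congr' (Eventually.of_forall fun y => ?_) EventuallyEq.rfl
  simp only [hv]
  rw [show (1 : ℝ) - (1 - Real.cos y) = Real.cos y by ring]
  ring

/-- `log(1 - q sin² y) + q y² + (q²/2 - q/3) y⁴ = o(y⁴)`. [folklore] -/
theorem log_one_sub_mul_sin_sq_isLittleO (q : ℝ) (hq : 0 ≤ q) :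
    (fun y : ℝ => Real.log (1 - q * Real.sin y ^ 2) + q * y ^ 2 + (q ^ 2 / 2 - q / 3) * y ^ 4)
      =o[𝓝 0] fun y : ℝ => y ^ 4 := by
  set u : ℝ → ℝ := fun y => q * Real.sin y ^ 2 with hu
  have hu0 : ∀ᶠ y in 𝓝 (0 : ℝ), 0 ≤ u y := Eventually.of_forall fun y => by
    simp only [hu]; positivity
  have hut : Tendsto u (𝓝 0) (𝓝 0) := by
    have : Tendsto u (𝓝 0) (𝓝 (q * Real.sin 0 ^ 2)) :=
      (continuous_const.mul (Real.continuous_sin.pow 2)).tendsto 0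
    simpa using this
  have h42 : (fun y : ℝ => y ^ 4) =O[𝓝 0] fun y : ℝ => y ^ 2 :=
    (isLittleO_pow_pow (by norm_num : 2 < 4)).isBigO
  -- `u - q(y² - y⁴/3) = o(y⁴)`, `u - qy² = O(y⁴)`, `u + qy² = O(y²)`
  have h1 : (fun y => u y - q * (y ^ 2 - y ^ 4 / 3)) =o[𝓝 0] fun y : ℝ => y ^ 4 := by
    refine (sin_sq_isLittleO.const_mul_left q).congr' (Eventually.of_forall fun y => ?_)
      EventuallyEq.rfl
    simp only [hu]; ring
  have hA : (fun y => u y - q * y ^ 2) =O[𝓝 0] fun y : ℝ => y ^ 4 := by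
    have := h1.isBigO.sub (isBigO_const_mul_self (q / 3) (fun y : ℝ => y ^ 4) (𝓝 0))
    refine this.congr' (Eventually.of_forall fun y => ?_) EventuallyEq.rfl
    ring
  have hB : (fun y => u y + q * y ^ 2) =O[𝓝 0] fun y : ℝ => y ^ 2 := by
    have := (hA.trans h42).add (isBigO_const_mul_self (2 * q) (fun y : ℝ => y ^ 2) (𝓝 0))
    refine this.congr' (Eventually.of_forall fun y => ?_) EventuallyEq.rfl
    ring
  have huO : u =O[𝓝 0] fun y : ℝ => y ^ 2 := by
    have := (hA.trans h42).add (isBigO_const_mul_self q (fun y : ℝ => y ^ 2) (𝓝 0))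
    refine this.congr' (Eventually.of_forall fun y => ?_) EventuallyEq.rfl
    ring
  have hsq : (fun y => (u y ^ 2 - q ^ 2 * y ^ 4) / 2) =O[𝓝 0] fun y : ℝ => y ^ 6 := by
    have := (hA.mul hB).const_mul_left (1 / 2)
    refine this.congr' (Eventually.of_forall fun y => ?_) (Eventually.of_forall fun y => ?_)
    · ring
    · ring
  have hlog : (fun y => Real.log (1 - u y) + u y + u y ^ 2 / 2) =O[𝓝 0] fun y : ℝ => y ^ 6 := by
    refine (log_one_sub_isBigO hu0 hut).trans ?_
    have := huO.pow 3
    exact this.congr_right fun y => by ring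
  have h64 : (fun y : ℝ => y ^ 6) =o[𝓝 0] fun y : ℝ => y ^ 4 := isLittleO_pow_pow (by norm_num)
  have := ((hlog.trans_isLittleO h64).sub h1).sub (hsq.trans_isLittleO h64)
  refine this.congr' (Eventually.of_forall fun y => ?_) EventuallyEq.rfl
  simp only [hu]
  ring

/-! ### The finite trigonometric product `cos(ωt)^a ∏_q (1 - q sin²(ωt))` and its expansion -/

/-- The finite trigonometric product `F(t) = cos(ωt)^a ∏_{q ∈ Q} (1 - q sin²(ωt))` (for `h_N`:
`q = 1/sin²(θ/2)` over the paired Lee–Yang angles). [folklore] -/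
def trigProd (ω : ℝ) (a : ℕ) (Q : Multiset ℝ) (t : ℝ) : ℝ :=
  Real.cos (ω * t) ^ a * (Q.map fun q => 1 - q * Real.sin (ω * t) ^ 2).prod

/-- The logarithm of the trigonometric product where all factors are positive. [folklore] -/
def logTrigProd (ω : ℝ) (a : ℕ) (Q : Multiset ℝ) (t : ℝ) : ℝ :=
  a * Real.log (Real.cos (ω * t)) + (Q.map fun q => Real.log (1 - q * Real.sin (ω * t) ^ 2)).sum

/-- `F = exp(log F)` when `cos(ωt) > 0` and every `1 - q sin²(ωt) > 0`. [folklore] -/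
theorem trigProd_eq_exp {ω : ℝ} {a : ℕ} {Q : Multiset ℝ} {t : ℝ} (hcos : 0 < Real.cos (ω * t))
    (hfac : ∀ q ∈ Q, 0 < 1 - q * Real.sin (ω * t) ^ 2) :
    trigProd ω a Q t = Real.exp (logTrigProd ω a Q t) := by
  rw [trigProd, logTrigProd, Real.exp_add, Real.exp_nat_mul, Real.exp_log hcos,
    Real.exp_multiset_sum, Multiset.map_map]
  congr 1
  refine congrArg Multiset.prod (Multiset.map_congr rfl fun q hq => ?_)
  simp [Real.exp_log (hfac q hq)]

/-- A multiset sum of `o(t⁴)` functions is `o(t⁴)`. [folklore] -/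
theorem isLittleO_multiset_sum {Q : Multiset ℝ} {g : ℝ → ℝ → ℝ} {l : Filter ℝ} {k : ℝ → ℝ}
    (h : ∀ q ∈ Q, (g q) =o[l] k) :
    (fun t => (Q.map fun q => g q t).sum) =o[l] k := by
  induction Q using Multiset.induction_on with
  | empty => simp
  | cons q Q ih =>
    have hq := h q (Multiset.mem_cons_self q Q)
    have hQ := ih fun q' hq' => h q' (Multiset.mem_cons_of_mem hq')
    simpa [Multiset.map_cons, Multiset.sum_cons] using hq.add hQ

/-- **Fourth-order expansion of `log F`**: with `A = ω²(a/2 + Σq)` and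
`C = ω⁴(a/12 + Σ(q²/2 - q/3))`, `log F(t) + At² + Ct⁴ = o(t⁴)`. [folklore] -/
theorem logTrigProd_isLittleO (ω : ℝ) (a : ℕ) {Q : Multiset ℝ} (hQ : ∀ q ∈ Q, 0 ≤ q) :
    (fun t => logTrigProd ω a Q t + ω ^ 2 * (a / 2 + Q.sum) * t ^ 2 +
      ω ^ 4 * (a / 12 + (Q.map fun q => q ^ 2 / 2 - q / 3).sum) * t ^ 4) =o[𝓝 0]
      fun t : ℝ => t ^ 4 := by
  have hω : Tendsto (fun t : ℝ => ω * t) (𝓝 0) (𝓝 0) := by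
    have := (tendsto_id (x := 𝓝 (0 : ℝ))).const_mul ω
    simpa using this
  have hpow : (fun t : ℝ => (ω * t) ^ 4) =O[𝓝 0] fun t : ℝ => t ^ 4 :=
    (isBigO_const_mul_self (ω ^ 4) (fun t : ℝ => t ^ 4) (𝓝 0)).congr_left fun t => by ring
  have hcos := (log_cos_isLittleO.comp_tendsto hω).trans_isBigO hpow
  have hsum : (fun t => (Q.map fun q => Real.log (1 - q * Real.sin (ω * t) ^ 2) + q * (ω * t) ^ 2
      + (q ^ 2 / 2 - q / 3) * (ω * t) ^ 4).sum) =o[𝓝 0] fun t : ℝ => t ^ 4 :=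
    isLittleO_multiset_sum fun q hq =>
      ((log_one_sub_mul_sin_sq_isLittleO q (hQ q hq)).comp_tendsto hω).trans_isBigO hpow
  have := (hcos.const_mul_left (a : ℝ)).add hsum
  refine this.congr' (Eventually.of_forall fun t => ?_) EventuallyEq.rfl
  simp only [Function.comp_apply, logTrigProd, Multiset.sum_map_add, Multiset.sum_map_mul_right,
    Multiset.map_id']
  ring

/-- **Fourth-order expansion of the trigonometric product at `0`**:
`F(t) = 1 - At² + (A²/2 - C)t⁴ + o(t⁴)`. [folklore] -/
theorem trigProd_isLittleO (ω : ℝ) (a : ℕ) {Q : Multiset ℝ} (hQ : ∀ q ∈ Q, 0 ≤ q) :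
    (fun t => trigProd ω a Q t - (1 - ω ^ 2 * (a / 2 + Q.sum) * t ^ 2 +
      ((ω ^ 2 * (a / 2 + Q.sum)) ^ 2 / 2 -
        ω ^ 4 * (a / 12 + (Q.map fun q => q ^ 2 / 2 - q / 3).sum)) * t ^ 4)) =o[𝓝 0]
      fun t : ℝ => t ^ 4 := by
  set A := ω ^ 2 * (a / 2 + Q.sum) with hA
  set C := ω ^ 4 * (a / 12 + (Q.map fun q => q ^ 2 / 2 - q / 3).sum) with hC
  set w := logTrigProd ω a Q with hw
  -- positivity of the factors near `0`
  have hP : ∀ᶠ t in 𝓝 (0 : ℝ), trigProd ω a Q t = Real.exp (w t) := by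
    have h1 : ∀ᶠ t in 𝓝 (0 : ℝ), 0 < Real.cos (ω * t) := by
      have : Tendsto (fun t : ℝ => Real.cos (ω * t)) (𝓝 0) (𝓝 (Real.cos (ω * 0))) :=
        (Real.continuous_cos.comp (continuous_const.mul continuous_id)).tendsto 0
      simp only [mul_zero, Real.cos_zero] at this
      exact this.eventually_const_lt (by norm_num)
    have h2 : ∀ᶠ t in 𝓝 (0 : ℝ), ∀ q ∈ Q.toFinset, 0 < 1 - q * Real.sin (ω * t) ^ 2 := by
      rw [Filter.eventually_all_finset]
      intro q _
      have : Tendsto (fun t : ℝ => 1 - q * Real.sin (ω * t) ^ 2) (𝓝 0)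
          (𝓝 (1 - q * Real.sin (ω * 0) ^ 2)) :=
        (continuous_const.sub (continuous_const.mul
          ((Real.continuous_sin.comp (continuous_const.mul continuous_id)).pow 2))).tendsto 0
      simp only [mul_zero, Real.sin_zero] at this
      norm_num at this
      exact this.eventually_const_lt (by norm_num)
    filter_upwards [h1, h2] with t ht1 ht2
    exact trigProd_eq_exp ht1 fun q hq => ht2 q (Multiset.mem_toFinset.2 hq)
  have hE : (fun t => w t + A * t ^ 2 + C * t ^ 4) =o[𝓝 0] fun t : ℝ => t ^ 4 := by
    have := logTrigProd_isLittleO ω a hQ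
    simpa only [hw, hA, hC] using this
  have h42 : (fun t : ℝ => t ^ 4) =O[𝓝 0] fun t : ℝ => t ^ 2 :=
    (isLittleO_pow_pow (by norm_num : 2 < 4)).isBigO
  have hA2 : (fun t : ℝ => A * t ^ 2) =O[𝓝 0] fun t : ℝ => t ^ 2 := isBigO_const_mul_self A _ _
  have hC4 : (fun t : ℝ => C * t ^ 4) =O[𝓝 0] fun t : ℝ => t ^ 4 := isBigO_const_mul_self _ _ _
  have hwO : w =O[𝓝 0] fun t : ℝ => t ^ 2 := by
    have := ((hE.isBigO.trans h42).sub hA2).sub (hC4.trans h42)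
    refine this.congr' ?_ EventuallyEq.rfl
    exact Eventually.of_forall fun t => by ring
  have hw0 : Tendsto w (𝓝 0) (𝓝 0) := by
    refine hwO.trans_tendsto ?_
    have : Tendsto (fun t : ℝ => t ^ 2) (𝓝 0) (𝓝 (0 ^ 2)) := (continuous_pow 2).tendsto 0
    simpa using this
  have h64 : (fun t : ℝ => t ^ 6) =o[𝓝 0] fun t : ℝ => t ^ 4 := isLittleO_pow_pow (by norm_num)
  have hexp : (fun t => Real.exp (w t) - 1 - w t - w t ^ 2 / 2) =o[𝓝 0] fun t : ℝ => t ^ 4 := by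
    have h1 : (fun t => Real.exp (w t) - 1 - w t - w t ^ 2 / 2) =O[𝓝 0] fun t => w t ^ 3 := by
      refine IsBigO.of_bound 1 ?_
      have hle : ∀ᶠ t in 𝓝 0, w t ≤ 1 := hw0.eventually_le_const (by norm_num)
      have hge : ∀ᶠ t in 𝓝 0, -1 ≤ w t := hw0.eventually_const_le (by norm_num)
      filter_upwards [hle, hge] with t h1 h2
      rw [Real.norm_eq_abs, Real.norm_eq_abs, one_mul, abs_pow]
      exact abs_exp_sub_le (abs_le.2 ⟨h2, h1⟩)
    refine (h1.trans ?_).trans_isLittleO h64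
    have := hwO.pow 3
    refine this.congr_right fun t => by ring
  have hsq : (fun t => w t ^ 2 / 2 - A ^ 2 * t ^ 4 / 2) =o[𝓝 0] fun t : ℝ => t ^ 4 := by
    have hp : (fun t => w t + A * t ^ 2) =O[𝓝 0] fun t : ℝ => t ^ 4 := by
      have := hE.isBigO.sub hC4
      refine this.congr' ?_ EventuallyEq.rfl
      exact Eventually.of_forall fun t => by ring_nf
    have hm : (fun t => w t - A * t ^ 2) =O[𝓝 0] fun t : ℝ => t ^ 2 := hwO.sub hA2
    have := (hp.mul hm).const_mul_left (1 / 2)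
    refine ((this.congr' ?_ ?_)).trans_isLittleO h64
    · exact Eventually.of_forall fun t => by ring
    · exact Eventually.of_forall fun t => by ring
  have hsum := (hexp.add hE).add hsq
  refine hsum.congr' ?_ EventuallyEq.rfl
  filter_upwards [hP] with t ht
  rw [ht]
  ring

/-! ### The data of `h_N` in the trigonometric product, and `μ₂, μ₄` in closed form -/

/-- **`ĥ_N` as a trigonometric product, with `μ_{2,N}` and `μ_{4,N}` in closed form** (`s > 0`):
there are `a ∈ ℕ` and a finite family `Q` of reals `q ≥ 1` (`q = 1/sin²(θ/2)` over the paired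
Lee–Yang angles) with `a + 2|Q| = 2^N`, `ĥ_N(ξ) = cos(ωξ)^a ∏_q (1 - q sin²(ωξ))`,
`ω = s(√c/2)^N`, and
`μ_{2,N} = ω²(a/2 + Σq)`, `μ_{4,N} = ω⁴(a/12 + Σ(q²/2 - q/3))`
(the Newman coordinates of §2.2 made finite and explicit; `μ_{4,N} ≥ 0` follows).
[cite: HaraHattoriWatanabe2001, §2.2 eqs. (2.7)–(2.9)] [cite: Newman1975, Theorem 3] -/
theorem traj_trigProd_data {s : ℝ} (hs : 0 < s) (N : ℕ) :
    ∃ (a : ℕ) (Q : Multiset ℝ), (∀ q ∈ Q, 1 ≤ q) ∧ a + 2 * Multiset.card Q = 2 ^ N ∧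
      (∀ ξ : ℝ, charFun (traj s N) ξ = (trigProd (s * hierK ^ N) a Q ξ : ℂ)) ∧
      mu2 (traj s N) = (s * hierK ^ N) ^ 2 * (a / 2 + Q.sum) ∧
      mu4 (traj s N) = (s * hierK ^ N) ^ 4 * (a / 12 + (Q.map fun q => q ^ 2 / 2 - q / 3).sum) := by
  obtain ⟨a, S, hS, hcard, hchar⟩ := charFun_traj_eq_trigProd hs N
  set ω := s * hierK ^ N with hω
  set Q : Multiset ℝ := S.map fun θ => (Real.sin (θ / 2) ^ 2)⁻¹ with hQ
  have hQ1 : ∀ q ∈ Q, 1 ≤ q := by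
    intro q hq
    obtain ⟨θ, hθ, rfl⟩ := Multiset.mem_map.1 hq
    obtain ⟨h0, hπ⟩ := hS θ hθ
    have hsin : 0 < Real.sin (θ / 2) := Real.sin_pos_of_pos_of_lt_pi (by linarith) (by linarith)
    rw [one_le_inv₀ (pow_pos hsin 2)]
    exact Real.sin_sq_le_one (θ / 2)
  have hchar' : ∀ ξ : ℝ, charFun (traj s N) ξ = (trigProd ω a Q ξ : ℂ) := by
    intro ξ
    rw [hchar ξ, trigProd, hQ, Multiset.map_map, mul_comm ξ ω]
    congr 3
    refine Multiset.map_congr rfl fun θ _ => ?_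
    simp only [Function.comp_apply]
    ring
  have hQ0 : ∀ q ∈ Q, 0 ≤ q := fun q hq => zero_le_one.trans (hQ1 q hq)
  have hm := moments_eq_of_charFun_expansion ((isBddLaw_traj s N).memLp_id 4) hchar'
    (trigProd_isLittleO ω a hQ0)
  refine ⟨a, Q, hQ1, by rw [hQ, Multiset.card_map]; exact hcard, hchar', ?_, ?_⟩
  · rw [mu2_eq, hm.1]; ring
  · rw [mu4_eq, hm.1, hm.2]; ring

/-! ### The quantitative logarithm of the trigonometric product -/

/-- `|log(1 - u) + u| ≤ 2u²` for `0 ≤ u ≤ ½` (from the third-order bound). The same two-term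
bound is `Literature.NumberTheory.Sieve.abs_log_one_sub_add_le` (BatemanHornProofs) and is kept
proof-internal in `RigorousRGSmallParameterHHWReduction`; private here to avoid a third public
copy and a cross-topic import. [folklore] -/
private theorem abs_log_one_sub_add_le' {u : ℝ} (hu : 0 ≤ u) (hu2 : u ≤ 1 / 2) :
    |Real.log (1 - u) + u| ≤ 2 * u ^ 2 := by
  have h := abs_log_one_sub_add_add_le hu hu2
  have h1 : |Real.log (1 - u) + u| ≤ |Real.log (1 - u) + u + u ^ 2 / 2| + u ^ 2 / 2 := by
    have := abs_add_le (Real.log (1 - u) + u + u ^ 2 / 2) (-(u ^ 2 / 2))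
    rw [abs_neg, abs_of_nonneg (by positivity : (0:ℝ) ≤ u ^ 2 / 2),
      show Real.log (1 - u) + u + u ^ 2 / 2 + -(u ^ 2 / 2) = Real.log (1 - u) + u by ring] at this
    exact this
  have h3 : u ^ 3 ≤ u ^ 2 / 2 := by nlinarith [sq_nonneg u]
  nlinarith [pow_nonneg hu 3, pow_nonneg hu 2]

/-- `|-log cos y - y²/2| ≤ y⁴/2` for `|y| ≤ ½`. [folklore] -/
theorem abs_neg_log_cos_sub_le {y : ℝ} (hy : |y| ≤ 1 / 2) :
    |-Real.log (Real.cos y) - y ^ 2 / 2| ≤ y ^ 4 / 2 := by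
  have hy1 : |y| ≤ 1 := hy.trans (by norm_num)
  have hy2 : y ^ 2 ≤ 1 / 4 := by
    have := pow_le_pow_left₀ (abs_nonneg y) hy 2
    rw [pow_abs, abs_of_nonneg (sq_nonneg y)] at this
    linarith [this]
  have hcosge : 1 - y ^ 2 / 2 ≤ Real.cos y := Real.one_sub_sq_div_two_le_cos
  have hcosle : Real.cos y ≤ 1 - y ^ 2 / 2 + y ^ 4 * (5 / 96) := by
    have := Real.cos_bound hy1
    rw [pow_abs, abs_of_nonneg (by positivity : (0:ℝ) ≤ y ^ 4)] at this
    linarith [(abs_le.1 this).2]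
  have hpos1 : 0 < 1 - y ^ 2 / 2 := by linarith
  have hcospos : 0 < Real.cos y := lt_of_lt_of_le hpos1 hcosge
  -- upper bound: `-log cos y ≤ -log(1 - y²/2) ≤ y²/2 + 2(y²/2)²`
  have hup : -Real.log (Real.cos y) ≤ y ^ 2 / 2 + 2 * (y ^ 2 / 2) ^ 2 := by
    have h1 : Real.log (1 - y ^ 2 / 2) ≤ Real.log (Real.cos y) := Real.log_le_log hpos1 hcosge
    have h2 := abs_log_one_sub_add_le' (u := y ^ 2 / 2) (by positivity) (by linarith)
    linarith [(abs_le.1 h2).1]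
  -- lower bound: `log cos y ≤ cos y - 1 ≤ -y²/2 + 5y⁴/96`
  have hlow : y ^ 2 / 2 - y ^ 4 * (5 / 96) ≤ -Real.log (Real.cos y) := by
    have := Real.log_le_sub_one_of_pos hcospos
    linarith
  rw [abs_le]
  constructor <;> nlinarith [sq_nonneg y, pow_nonneg (sq_nonneg y) 2]

/-- `|sin² y - y²| ≤ (5/12) y⁴` for `|y| ≤ ½` (from `sin² y = (1 - cos 2y)/2` and `cos_bound`).
[folklore] -/
theorem abs_sin_sq_sub_sq_le {y : ℝ} (hy : |y| ≤ 1 / 2) : |Real.sin y ^ 2 - y ^ 2| ≤ 5 / 12 * y ^ 4 := by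
  have h2y : |2 * y| ≤ 1 := by rw [abs_mul, abs_two]; linarith
  have := Real.cos_bound h2y
  rw [pow_abs, abs_of_nonneg (by positivity : (0:ℝ) ≤ (2 * y) ^ 4)] at this
  rw [Real.sin_sq_eq_half_sub]
  have e : (1 : ℝ) / 2 - Real.cos (2 * y) / 2 - y ^ 2 = -(Real.cos (2 * y) - (1 - (2 * y) ^ 2 / 2)) / 2 := by
    ring
  rw [e, abs_div, abs_neg, abs_two]
  calc |Real.cos (2 * y) - (1 - (2 * y) ^ 2 / 2)| / 2 ≤ (2 * y) ^ 4 * (5 / 96) / 2 := by gcongr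
    _ = 5 / 12 * y ^ 4 := by ring

/-- **The logarithm of the trigonometric product, quantitatively**: if `|ωt| ≤ ½` and
`q(ωt)² ≤ ½` for every `q ∈ Q` (`q ≥ 0`), then `F(t) > 0` and
`|-log F(t) - (a/2 + Σq)(ωt)²| ≤ (a/2 + (5/12)Σq + 2Σq²)(ωt)⁴` — the mechanism of the last step
on p. 6 (`μ₄ → 0` forces `ĥ_N(ξ) → e^{-μ₂ξ²}`). [cite: HaraHattoriWatanabe2001, §2.3 (p. 6)] -/
theorem abs_neg_log_trigProd_sub_le {ω : ℝ} {a : ℕ} {Q : Multiset ℝ} (hQ : ∀ q ∈ Q, 0 ≤ q)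
    {t : ℝ} (hy : |ω * t| ≤ 1 / 2) (hsmall : ∀ q ∈ Q, q * (ω * t) ^ 2 ≤ 1 / 2) :
    0 < trigProd ω a Q t ∧
    |-Real.log (trigProd ω a Q t) - (a / 2 + Q.sum) * (ω * t) ^ 2| ≤
      (a / 2 + 5 / 12 * Q.sum + 2 * (Q.map fun q => q ^ 2).sum) * (ω * t) ^ 4 := by
  set y := ω * t with hy_def
  have hy2 : y ^ 2 ≤ 1 / 4 := by
    have := pow_le_pow_left₀ (abs_nonneg y) hy 2
    rw [pow_abs, abs_of_nonneg (sq_nonneg y)] at this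
    linarith [this]
  have hcos : 0 < Real.cos y := lt_of_lt_of_le (by linarith) Real.one_sub_sq_div_two_le_cos
  have hu : ∀ q ∈ Q, 0 ≤ q * Real.sin y ^ 2 ∧ q * Real.sin y ^ 2 ≤ 1 / 2 := fun q hq =>
    ⟨mul_nonneg (hQ q hq) (sq_nonneg _),
      (mul_le_mul_of_nonneg_left (Real.sin_sq_le_sq (x := y)) (hQ q hq)).trans (hsmall q hq)⟩
  have hfac : ∀ q ∈ Q, 0 < 1 - q * Real.sin y ^ 2 := fun q hq => by linarith [(hu q hq).2]
  refine ⟨?_, ?_⟩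
  · rw [trigProd_eq_exp hcos hfac]; exact Real.exp_pos _
  rw [trigProd_eq_exp hcos hfac, Real.log_exp, logTrigProd]
  -- the three error terms
  have e1 := abs_neg_log_cos_sub_le hy
  have e2 : |(Q.map fun q => -Real.log (1 - q * Real.sin y ^ 2) - q * Real.sin y ^ 2).sum| ≤
      (Q.map fun q => 2 * q ^ 2 * y ^ 4).sum := by
    have hb : ∀ q ∈ Q, |-Real.log (1 - q * Real.sin y ^ 2) - q * Real.sin y ^ 2| ≤ 2 * q ^ 2 * y ^ 4 := by
      intro q hq
      have h := abs_log_one_sub_add_le' (hu q hq).1 (hu q hq).2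
      rw [show -Real.log (1 - q * Real.sin y ^ 2) - q * Real.sin y ^ 2 =
        -(Real.log (1 - q * Real.sin y ^ 2) + q * Real.sin y ^ 2) by ring, abs_neg]
      refine h.trans ?_
      have hs4 : Real.sin y ^ 2 * Real.sin y ^ 2 ≤ y ^ 2 * y ^ 2 :=
        mul_le_mul (Real.sin_sq_le_sq) (Real.sin_sq_le_sq) (sq_nonneg _) (sq_nonneg _)
      have hq0 := hQ q hq
      nlinarith [sq_nonneg q]
    rw [abs_le]
    constructor
    · have := Multiset.sum_map_le_sum_map (s := Q) (fun q => -(2 * q ^ 2 * y ^ 4))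
        (fun q => -Real.log (1 - q * Real.sin y ^ 2) - q * Real.sin y ^ 2)
        fun q hq => (abs_le.1 (hb q hq)).1
      rw [Multiset.sum_map_neg] at this
      exact this
    · exact Multiset.sum_map_le_sum_map _ _ fun q hq => (abs_le.1 (hb q hq)).2
  have e3 := abs_sin_sq_sub_sq_le hy
  -- assemble
  have hdecomp : -(↑a * Real.log (Real.cos y) + (Q.map fun q => Real.log (1 - q * Real.sin y ^ 2)).sum)
      - (↑a / 2 + Q.sum) * y ^ 2 =
      ↑a * (-Real.log (Real.cos y) - y ^ 2 / 2) +
      (Q.map fun q => -Real.log (1 - q * Real.sin y ^ 2) - q * Real.sin y ^ 2).sum +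
      Q.sum * (Real.sin y ^ 2 - y ^ 2) := by
    simp only [Multiset.sum_map_sub, Multiset.sum_map_neg, Multiset.sum_map_mul_right,
      Multiset.map_id']
    ring
  rw [hdecomp]
  have hQs : 0 ≤ Q.sum := Multiset.sum_nonneg hQ
  have hsq2 : (Q.map fun q => 2 * q ^ 2 * y ^ 4).sum = 2 * (Q.map fun q => q ^ 2).sum * y ^ 4 := by
    rw [Multiset.sum_map_mul_right, Multiset.sum_map_mul_left]
  rw [hsq2] at e2
  calc |↑a * (-Real.log (Real.cos y) - y ^ 2 / 2) +
        (Q.map fun q => -Real.log (1 - q * Real.sin y ^ 2) - q * Real.sin y ^ 2).sum +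
        Q.sum * (Real.sin y ^ 2 - y ^ 2)|
      ≤ |↑a * (-Real.log (Real.cos y) - y ^ 2 / 2)| +
        |(Q.map fun q => -Real.log (1 - q * Real.sin y ^ 2) - q * Real.sin y ^ 2).sum| +
        |Q.sum * (Real.sin y ^ 2 - y ^ 2)| := abs_add_three _ _ _
    _ ≤ ↑a * (y ^ 4 / 2) + 2 * (Q.map fun q => q ^ 2).sum * y ^ 4 + Q.sum * (5 / 12 * y ^ 4) := by
        gcongr
        · rw [abs_mul, abs_of_nonneg (Nat.cast_nonneg a)]
          exact mul_le_mul_of_nonneg_left e1 (Nat.cast_nonneg a)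
        · rw [abs_mul, abs_of_nonneg hQs]
          exact mul_le_mul_of_nonneg_left e3 hQs
    _ = (↑a / 2 + 5 / 12 * Q.sum + 2 * (Q.map fun q => q ^ 2).sum) * y ^ 4 := by ring

/-! ### `μ_{2,N} → 1`, `μ_{4,N} → 0` force `ĥ_N(ξ) → e^{-ξ²}` -/

/-- **The last step of the proof of Theorem 1.1 (p. 6), quantitatively**: along a trajectory
with `s > 0`, if `μ_{4,N} → 0` then for every real `ξ`, eventually in `N`, `ĥ_N(ξ)` is a positive
real number `F_N` with `|-log F_N - μ_{2,N}ξ²| ≤ 21 μ_{4,N} ξ⁴`. (From `traj_trigProd_data`: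
`ω⁴ ≤ 12μ₄`, `ω⁴Σq² ≤ 6μ₄`, so the smallness conditions of `abs_neg_log_trigProd_sub_le` hold
eventually, and its error is `≤ 21μ₄ξ⁴`.) With `μ_{2,N} → 1` this gives `ĥ_N(ξ) → e^{-ξ²}`, which
the tree states as `tendsto_charFun_traj` (`…HHWReduction`).
[cite: HaraHattoriWatanabe2001, §2.3 "Proof of Theorem 1.1" (p. 6)] -/
theorem eventually_charFun_traj_log_bound {s : ℝ} (hs : 0 < s)
    (h4 : Tendsto (fun N => mu4 (traj s N)) atTop (𝓝 0)) (ξ : ℝ) :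
    ∀ᶠ N in atTop, ∃ F : ℝ, charFun (traj s N) ξ = (F : ℂ) ∧ 0 < F ∧
      |-Real.log F - mu2 (traj s N) * ξ ^ 2| ≤ 21 * mu4 (traj s N) * ξ ^ 4 := by
  choose a Q hQ1 hcard hchar hmu2 hmu4 using fun N => traj_trigProd_data hs N
  set ω : ℕ → ℝ := fun N => s * hierK ^ N with hω
  have hQ0 : ∀ N, ∀ q ∈ Q N, 0 ≤ q := fun N q hq => zero_le_one.trans (hQ1 N q hq)
  -- `Σq ≤ Σq²`, `|Q| ≤ Σq²`
  have hQ12 : ∀ N, (Q N).sum ≤ ((Q N).map fun q => q ^ 2).sum := fun N => by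
    conv_lhs => rw [← Multiset.map_id' (Q N)]
    exact Multiset.sum_map_le_sum_map _ _ fun q hq => by have := hQ1 N q hq; nlinarith
  have hcardQ : ∀ N, (Multiset.card (Q N) : ℝ) ≤ ((Q N).map fun q => q ^ 2).sum := fun N => by
    have := Multiset.card_nsmul_le_sum (s := (Q N).map fun q => q ^ 2) (a := 1)
      (fun x hx => by
        obtain ⟨q, hq, rfl⟩ := Multiset.mem_map.1 hx
        have := hQ1 N q hq; nlinarith)
    simpa [Multiset.card_map] using this
  -- the key inequalities `ω⁴ a ≤ 12 μ₄`, `ω⁴ Σq² ≤ 6 μ₄`, `ω⁴ ≤ 12 μ₄`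
  have hmu4_ge : ∀ N, ω N ^ 4 * (a N / 12 + ((Q N).map fun q => q ^ 2).sum / 6) ≤ mu4 (traj s N) := by
    intro N
    rw [hmu4 N]
    refine mul_le_mul_of_nonneg_left ?_ (by positivity)
    have : ((Q N).map fun q => q ^ 2).sum / 6 ≤ ((Q N).map fun q => q ^ 2 / 2 - q / 3).sum := by
      rw [Multiset.sum_map_sub, Multiset.sum_map_div, Multiset.sum_map_div, Multiset.map_id']
      linarith [hQ12 N]
    linarith
  have hωpos : ∀ N, 0 < ω N := fun N => mul_pos hs (pow_pos hierK_pos N)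
  have hA : ∀ N, ω N ^ 4 * a N ≤ 12 * mu4 (traj s N) := fun N => by
    have := hmu4_ge N
    have : 0 ≤ ω N ^ 4 * ((Q N).map fun q => q ^ 2).sum :=
      mul_nonneg (by positivity) (Multiset.sum_nonneg fun x hx => by
        obtain ⟨q, _, rfl⟩ := Multiset.mem_map.1 hx; positivity)
    nlinarith
  have hB : ∀ N, ω N ^ 4 * ((Q N).map fun q => q ^ 2).sum ≤ 6 * mu4 (traj s N) := fun N => by
    have := hmu4_ge N
    have : 0 ≤ ω N ^ 4 * a N := by positivity
    nlinarith
  have hC : ∀ N, ω N ^ 4 ≤ 12 * mu4 (traj s N) := fun N => by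
    have hN : 1 ≤ a N + 2 * Multiset.card (Q N) := by rw [hcard N]; exact Nat.one_le_two_pow
    rcases Nat.eq_zero_or_pos (a N) with ha | ha
    · have hc : 1 ≤ Multiset.card (Q N) := by omega
      have : (1 : ℝ) ≤ ((Q N).map fun q => q ^ 2).sum :=
        le_trans (by exact_mod_cast hc) (hcardQ N)
      calc ω N ^ 4 = ω N ^ 4 * 1 := (mul_one _).symm
        _ ≤ ω N ^ 4 * ((Q N).map fun q => q ^ 2).sum := by gcongr
        _ ≤ 6 * mu4 (traj s N) := hB N
        _ ≤ 12 * mu4 (traj s N) := by linarith [mu4_traj_nonneg hs.le N]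
    · calc ω N ^ 4 = ω N ^ 4 * 1 := (mul_one _).symm
        _ ≤ ω N ^ 4 * a N := by gcongr; exact_mod_cast ha
        _ ≤ 12 * mu4 (traj s N) := hA N
  -- smallness, eventually
  have hsmall : ∀ᶠ N in atTop, |ω N * ξ| ≤ 1 / 2 ∧ ∀ q ∈ Q N, q * (ω N * ξ) ^ 2 ≤ 1 / 2 := by
    have h4' : Tendsto (fun N => 12 * mu4 (traj s N) * ξ ^ 4) atTop (𝓝 0) := by
      have := (h4.const_mul 12).mul_const (ξ ^ 4); simpa using this
    filter_upwards [h4'.eventually_le_const (show (0:ℝ) < 1 / 16 by norm_num)] with N hN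
    have hy4 : (ω N * ξ) ^ 4 ≤ 1 / 16 := by
      calc (ω N * ξ) ^ 4 = ω N ^ 4 * ξ ^ 4 := by ring
        _ ≤ 12 * mu4 (traj s N) * ξ ^ 4 := by gcongr; exact hC N
        _ ≤ 1 / 16 := hN
    have hy : |ω N * ξ| ≤ 1 / 2 := by
      have : |ω N * ξ| ^ 4 ≤ (1 / 2) ^ 4 := by rw [pow_abs, abs_of_nonneg (by positivity)]; norm_num; exact hy4
      exact (pow_le_pow_iff_left₀ (abs_nonneg _) (by norm_num) (by norm_num)).1 this
    refine ⟨hy, fun q hq => ?_⟩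
    have hq0 := hQ0 N q hq
    have hsq : (q * (ω N * ξ) ^ 2) ^ 2 ≤ (1 / 2) ^ 2 := by
      have hq2 : q ^ 2 ≤ ((Q N).map fun q => q ^ 2).sum :=
        Multiset.single_le_sum (fun x hx => by
          obtain ⟨q', _, rfl⟩ := Multiset.mem_map.1 hx; positivity) _ (Multiset.mem_map_of_mem _ hq)
      have hξ4 : 0 ≤ ξ ^ 4 := by positivity
      have hω4 : 0 ≤ ω N ^ 4 := by positivity
      calc (q * (ω N * ξ) ^ 2) ^ 2 = q ^ 2 * ω N ^ 4 * ξ ^ 4 := by ring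
        _ ≤ ((Q N).map fun q => q ^ 2).sum * ω N ^ 4 * ξ ^ 4 := by gcongr
        _ ≤ 6 * mu4 (traj s N) * ξ ^ 4 := by
            have := mul_le_mul_of_nonneg_right (hB N) hξ4
            linarith [this]
        _ ≤ (1 / 2) ^ 2 := by linarith [mu4_traj_nonneg hs.le N]
    exact (pow_le_pow_iff_left₀ (by positivity) (by norm_num) two_ne_zero).1 hsq
  -- the real numbers `F_N(ξ)` and their logarithms
  set p : ℕ → ℝ := fun N => trigProd (ω N) (a N) (Q N) ξ with hp
  have hplog : ∀ᶠ N in atTop, 0 < p N ∧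
      |-Real.log (p N) - mu2 (traj s N) * ξ ^ 2| ≤ 21 * mu4 (traj s N) * ξ ^ 4 := by
    filter_upwards [hsmall] with N hN
    obtain ⟨hpos, hbd⟩ := abs_neg_log_trigProd_sub_le (a := a N) (hQ0 N) hN.1 hN.2
    refine ⟨hpos, ?_⟩
    have e : mu2 (traj s N) * ξ ^ 2 = (a N / 2 + (Q N).sum) * (ω N * ξ) ^ 2 := by
      rw [hmu2 N]; ring
    rw [e]
    refine hbd.trans ?_
    have h1 := hA N
    have h2 := hB N
    have h3 := hQ12 N
    have hQs : 0 ≤ (Q N).sum := Multiset.sum_nonneg (hQ0 N)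
    have h3' : (Q N).sum * ω N ^ 4 ≤ ((Q N).map fun q => q ^ 2).sum * ω N ^ 4 :=
      mul_le_mul_of_nonneg_right h3 (by positivity)
    have : (a N / 2 + 5 / 12 * (Q N).sum + 2 * ((Q N).map fun q => q ^ 2).sum) * ω N ^ 4 ≤
        21 * mu4 (traj s N) := by
      have h0 := mu4_traj_nonneg hs.le N
      nlinarith [h1, h2, h3', h0]
    calc (a N / 2 + 5 / 12 * (Q N).sum + 2 * ((Q N).map fun q => q ^ 2).sum) * (ω N * ξ) ^ 4
        = ((a N / 2 + 5 / 12 * (Q N).sum + 2 * ((Q N).map fun q => q ^ 2).sum) * ω N ^ 4) * ξ ^ 4 := by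
          ring
      _ ≤ 21 * mu4 (traj s N) * ξ ^ 4 := by gcongr
  filter_upwards [hplog] with N hN
  exact ⟨p N, hchar N ξ, hN.1, hN.2⟩

end HierarchicalRG

end Literature.Barriers.CriticalPhenomena

end
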